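/-
Copyright: derived here (Resolution Observatory cell `pub-rosobs`, carver gen 51). AI-written Lean; AI review is
weaker than expert review.  Companion file of the cell's POLYNOMIAL weighted-centre model `W(f)`: the LOG-DERIVATIVE
`X_Φ = Φ⁻¹ ∘ ∂_σ ∘ Φ − ∂_σ` of an invertible substitution `Φ` and its CONJUGATION-EQUIVARIANCE under `σ`-free automorphisms
(engine 1's T9 LEMMA D (1); THEOREM-LC-eng1-g33 STEP 4; THEOREM-FQ-eng1-g34 §16 (4₁)/(4♭′), §16.5 (v.0); CARVER-NOTES-eng1-g34 T21
(construction half and addendum) and T22 (a)–(b)).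
Instrument — NOT a resolution theorem and NOT a statement about the invariant of [AbramovichTemkinWlodarczyk2024].
-/
import Mathlib.RingTheory.Derivation.Basic
import Mathlib.Algebra.Polynomial.Derivation
import Mathlib.Algebra.Polynomial.AlgebraMap
import Mathlib.Algebra.MvPolynomial.Derivation
import HarnessLib

/-!
# The log-derivative of a substitution and its conjugation-equivariance

Setting (§1, abstract): `B` a commutative `R`-algebra, `D` an `R`-derivation of `B`, `Φ` an `R`-algebra automorphism of `B`.
The **conjugate** `Φ⁻¹ ∘ D ∘ Φ` (`conjDerivation Φ D`) is again an `R`-derivation, and the **log-derivative**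

  `X_Φ := Φ⁻¹ ∘ D ∘ Φ − D`     (`logDerivation D Φ`)

is an `R`-derivation of `B` which vanishes iff `Φ` commutes with `D` (`logDerivation_eq_zero_iff`).  Identities (by unfolding):
* `map_logDerivation_of_apply_eq_zero` : `D b = 0 ⇒ Φ (X_Φ b) = D (Φ b)` — the INTERTWINING identity `Ψ̄ (X̄ f) = ∂_σ (Ψ̄ f)`
  (`σ`-free `f`) which `WeightedCentreNoBands.xbar_eq_zero_of_boundary_relation` takes as its hypothesis `hder`: for an
  invertible substitution the `X̄` of LEMMA LQ STEP 4_Q is `logDerivation` itself (no truncated logarithm is needed);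
* `logDerivation_trans` (cocycle `X_{Φ∘Ψ} = Ψ⁻¹ X_Φ Ψ + X_Ψ`), `logDerivation_symm` (`X_{Φ⁻¹} = −Φ X_Φ Φ⁻¹`);
* `logDerivation_conj` (**T22 (a)**, conjugation-equivariance): `τ` commutes with `D ⇒ X_{τ⁻¹Φτ} = τ⁻¹ ∘ X_Φ ∘ τ`
  (with `τ⁻¹Φτ := (τ.trans Φ).trans τ.symm`, i.e. `b ↦ τ⁻¹(Φ(τ b))`); such a `τ` has `X_τ = 0`;
* `logDerivation_eq_neg_of_map_eq_sub` (**T22 (b)**, `(Rα) ⇒ (R∂)`): `D R = 0`, `Φ R = R − P ⇒ X_Φ R = −Φ⁻¹ (D P)`;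
* `logDerivation_eq_neg_mul_of_map_eq_sub_mul` (**T21 addendum (4₁)**): `D G₀ = D K = D B = 0`, `Φ G₀ = G₀ − B·Φ K ⇒
  X_Φ G₀ = −Φ⁻¹(B)·X_Φ K`;
* `logDerivation_eq_of_map_eq_sub_sub` (**(4♭′)**, two bands): `Φ G₀ = G₀ − B₁·Φ K₁ − B₂·Φ K₂ ⇒ X_Φ G₀ = −Φ⁻¹(B₁)·X_Φ K₁ − Φ⁻¹(B₂)·X_Φ K₂`
  (model: `coeffLayer_eq_zero_of_two_bands`, `coeffLayer_add_eq_of_two_bands` — `X_k G₀ = 0` below both bands, `X_{j+e₁} G₀ = −b₁·X_j K₁` between them);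
* `logDerivation_mul_of_fixed` : `Φ s = s`, `Φ (D s) = D s ⇒ X_Φ (s·b) = s·X_Φ b` (linearity over fixed constants, e.g. `s = σ`).

Model (§2): `B = A[σ] = A[X]` over a commutative `R`-algebra `A` (the cell: `A = k[ε_ι]`, `R = k`, `σ` the parameter of the
weighted centre), `D = ∂_σ = sigmaDeriv R A` (`Polynomial.derivative` as an `R`-derivation), `Φ : A[σ] ≃ₐ[R] A[σ]`:
* `map_logDerivation_C` : `Φ (X_Φ (C a)) = ∂_σ (Φ (C a))` — the `hder` of `WeightedCentreNoBands` verbatim for `X̄ a := X_Φ (C a)`;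
  `logDerivation_C` : `X_Φ (C a) = Φ⁻¹ (∂_σ Φ (C a))` — engine 1's `h̄_i = (∂_σ Ā_i)(σ, ε' + B̄)` for `a = ε_i`, `Φ = Ψ̄`;
* `logDerivation_X_eq_zero`, `logDerivation_X_pow_mul` : `Φ σ = σ ⇒ X_Φ σ = 0` and `X_Φ` is `σ`-linear;
* `coeffLayer X k` : the `σ^k`-LAYER `X_k : a ↦ [σ^k] X(C a)` of an `R`-derivation `X` of `A[σ]` is an `R`-derivation of `A`;
* `σ`-FREE automorphisms `τ = mapAlgEquiv τ₀` (`τ₀ : A ≃ₐ[R] A` on coefficients) commute with `∂_σ` (`mapAlgEquiv_derivative`), have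
  `X_τ = 0` (`logDerivation_mapAlgEquiv`), and — **T22 (a) layer by layer** — `(X_{τ⁻¹Φτ})_k = τ₀⁻¹ ∘ (X_Φ)_k ∘ τ₀`
  (`coeffLayer_logDerivation_conj`);
* `logDerivation_C_eq_neg_of_map_C_eq_sub` (`(Rα) ⇒ (R∂)` of THEOREM-FQ §16.5 (v.1)–(v.2)): `Φ (C R) = C R − P ⇒ X_Φ (C R) = −Φ⁻¹ (∂_σ P)`;
* `coeffLayer_eq_zero_of_boundary_relation` / `coeffLayer_add_eq_of_boundary_relation` (**(4₁)** layer by layer): if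
  `Φ (C G₀) = C G₀ − B·Φ (C K)` with `Φ⁻¹ B = C b·σ^e` then `X_k G₀ = 0` for `k < e` and `X_{e+j} G₀ = −b·X_j K`;
* `derivation_polynomial_ext`, `derivation_mvPolynomialX_ext` : an `R`-derivation of `A[σ]` (resp. of `k[ε_ι][σ]`) is determined by
  its values on `σ` and `A` (resp. on `σ` and the `ε_i`) — so `X_Φ` IS engine 1's `X̄ = Σ_i h̄_i ∂_i`.

What is NOT here: invertibility of the cell's graded unipotent substitutions (T9 (F0), a weight induction), the weight bookkeeping
"`X̄_k` lowers weights by `(k+1)ρ`", and the §16.5 weight arithmetic (v.3) (finite; script-checked by engine 1: code/eng1g34/chclose34.py,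
conjcheck34.py).

[ATW24] Abramovich–Temkin–Włodarczyk, Algebra & Number Theory 18 (2024), §5.1 (p. 1575): CONTEXT ONLY (weighted centres; the parameter
`σ`).  [Matsumura1987] §25: derivations of polynomial rings (context for §2).  The packaging is ours.
-/

namespace Literature.AlgebraicGeometry.Resolution.WeightedBlowup

section Abstract

variable {R B : Type*} [CommRing R] [CommRing B] [Algebra R B]

/-- The conjugate `Φ⁻¹ ∘ D ∘ Φ` of an `R`-derivation `D` of `B` by an `R`-algebra automorphism `Φ` is an `R`-derivation (derived here;
engine 1's T9 LEMMA D (1)). [cite: Matsumura1987, §25 (derivations)] -/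
def conjDerivation (Φ : B ≃ₐ[R] B) (D : Derivation R B B) : Derivation R B B where
  toFun b := Φ.symm (D (Φ b))
  map_add' a b := by simp only [map_add]
  map_smul' r a := by simp only [map_smul, Derivation.map_smul, RingHom.id_apply]
  map_one_eq_zero' := by simp only [LinearMap.coe_mk, AddHom.coe_mk, map_one, Derivation.map_one_eq_zero, map_zero]
  leibniz' a b := by
    simp only [LinearMap.coe_mk, AddHom.coe_mk, map_mul, Derivation.leibniz, smul_eq_mul, map_add, AlgEquiv.symm_apply_apply]

/-- Unfolding (derived here). [cite: Matsumura1987, §25 (derivations)] -/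
@[simp] theorem conjDerivation_apply (Φ : B ≃ₐ[R] B) (D : Derivation R B B) (b : B) :
    conjDerivation Φ D b = Φ.symm (D (Φ b)) := rfl

/-- The **log-derivative** `X_Φ = Φ⁻¹ ∘ D ∘ Φ − D` of the automorphism `Φ` with respect to the derivation `D` (derived here; the cell's
`X̄` of a substitution `Ψ̄`, T9 LEMMA D (1) / THEOREM-LC STEP 4). [cite: AbramovichTemkinWlodarczyk2024, §5.1 (p. 1575)] -/
def logDerivation (D : Derivation R B B) (Φ : B ≃ₐ[R] B) : Derivation R B B :=
  conjDerivation Φ D - D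

variable (D : Derivation R B B) (Φ : B ≃ₐ[R] B)

/-- Unfolding: `X_Φ b = Φ⁻¹ (D (Φ b)) − D b` (derived here). [cite: AbramovichTemkinWlodarczyk2024, §5.1 (p. 1575)] -/
theorem logDerivation_apply (b : B) : logDerivation D Φ b = Φ.symm (D (Φ b)) - D b := rfl

/-- `Φ (X_Φ b) = D (Φ b) − Φ (D b)` (derived here). [cite: AbramovichTemkinWlodarczyk2024, §5.1 (p. 1575)] -/
theorem map_logDerivation (b : B) : Φ (logDerivation D Φ b) = D (Φ b) - Φ (D b) := by
  rw [logDerivation_apply, map_sub, AlgEquiv.apply_symm_apply]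

/-- **Intertwining identity** (derived here): for `D b = 0`, `Φ (X_Φ b) = D (Φ b)` — the hypothesis `hder` of
`WeightedCentreNoBands.xbar_eq_zero_of_boundary_relation` (`Ψ̄ (X̄ f) = ∂_σ (Ψ̄ f)` for `σ`-free `f`).
[cite: AbramovichTemkinWlodarczyk2024, §5.1 (p. 1575)] -/
theorem map_logDerivation_of_apply_eq_zero {b : B} (hb : D b = 0) : Φ (logDerivation D Φ b) = D (Φ b) := by
  rw [map_logDerivation, hb, map_zero, sub_zero]

/-- For `D b = 0`: `X_Φ b = Φ⁻¹ (D (Φ b))` (derived here; engine 1's `h̄_i = (∂_σ Ā_i)(σ, ε' + B̄)`).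
[cite: AbramovichTemkinWlodarczyk2024, §5.1 (p. 1575)] -/
theorem logDerivation_apply_of_apply_eq_zero {b : B} (hb : D b = 0) : logDerivation D Φ b = Φ.symm (D (Φ b)) := by
  rw [logDerivation_apply, hb, sub_zero]

/-- `X_{id} = 0` (derived here). [cite: AbramovichTemkinWlodarczyk2024, §5.1 (p. 1575)] -/
theorem logDerivation_refl : logDerivation D (AlgEquiv.refl : B ≃ₐ[R] B) = 0 := by
  ext b
  rw [logDerivation_apply, Derivation.zero_apply, AlgEquiv.refl_symm, AlgEquiv.coe_refl, id, id, sub_self]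

/-- `X_Φ = 0` iff `Φ` commutes with `D` (derived here). [cite: AbramovichTemkinWlodarczyk2024, §5.1 (p. 1575)] -/
theorem logDerivation_eq_zero_iff : logDerivation D Φ = 0 ↔ ∀ b, Φ (D b) = D (Φ b) := by
  constructor
  · intro h b
    have hb := Derivation.congr_fun h b
    rw [logDerivation_apply, Derivation.zero_apply, sub_eq_zero] at hb
    rw [← hb, AlgEquiv.apply_symm_apply]
  · intro h
    ext b
    rw [logDerivation_apply, Derivation.zero_apply, sub_eq_zero, ← h, AlgEquiv.symm_apply_apply]

/-- An automorphism commuting with `D` has zero log-derivative (derived here; e.g. a `σ`-free automorphism).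
[cite: AbramovichTemkinWlodarczyk2024, §5.1 (p. 1575)] -/
theorem logDerivation_eq_zero_of_commute (h : ∀ b, Φ (D b) = D (Φ b)) : logDerivation D Φ = 0 :=
  (logDerivation_eq_zero_iff D Φ).mpr h

/-- **Cocycle identity** (derived here): `X_{Φ∘Ψ} = Ψ⁻¹ ∘ X_Φ ∘ Ψ + X_Ψ` (`Ψ.trans Φ = Φ ∘ Ψ`).
[cite: AbramovichTemkinWlodarczyk2024, §5.1 (p. 1575)] -/
theorem logDerivation_trans (Ψ : B ≃ₐ[R] B) (b : B) :
    logDerivation D (Ψ.trans Φ) b = Ψ.symm (logDerivation D Φ (Ψ b)) + logDerivation D Ψ b := by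
  simp only [logDerivation_apply, AlgEquiv.trans_apply, AlgEquiv.symm_trans_apply, map_sub]
  abel

/-- `X_{Φ⁻¹} = −Φ ∘ X_Φ ∘ Φ⁻¹` (derived here). [cite: AbramovichTemkinWlodarczyk2024, §5.1 (p. 1575)] -/
theorem logDerivation_symm (b : B) : logDerivation D Φ.symm b = -Φ (logDerivation D Φ (Φ.symm b)) := by
  simp only [logDerivation_apply, AlgEquiv.symm_symm, map_sub, AlgEquiv.apply_symm_apply]
  abel

variable {D} in
/-- An automorphism commuting with `D` has an inverse commuting with `D` (derived here). [cite: Matsumura1987, §25 (derivations)] -/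
theorem symm_map_eq_of_commute {τ : B ≃ₐ[R] B} (hτ : ∀ b, τ (D b) = D (τ b)) (b : B) : τ.symm (D b) = D (τ.symm b) := by
  apply τ.injective
  rw [AlgEquiv.apply_symm_apply, hτ, AlgEquiv.apply_symm_apply]

/-- **T22 (a): conjugation-equivariance of the log-derivative** (derived here; THEOREM-FQ-eng1-g34 §16.5 (v.0)).  If `τ` commutes with
`D` (e.g. a `σ`-free automorphism, `D = ∂_σ`) then `X_{τ⁻¹Φτ} = τ⁻¹ ∘ X_Φ ∘ τ`, where `τ⁻¹Φτ : b ↦ τ⁻¹(Φ(τ b))` is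
`(τ.trans Φ).trans τ.symm`. [cite: AbramovichTemkinWlodarczyk2024, §5.1 (p. 1575)] -/
theorem logDerivation_conj (τ : B ≃ₐ[R] B) (hτ : ∀ b, τ (D b) = D (τ b)) (b : B) :
    logDerivation D ((τ.trans Φ).trans τ.symm) b = τ.symm (logDerivation D Φ (τ b)) := by
  have h1 : τ (D (τ.symm (Φ (τ b)))) = D (Φ (τ b)) := by rw [hτ, AlgEquiv.apply_symm_apply]
  have h2 : τ.symm (D (τ b)) = D b := by rw [symm_map_eq_of_commute hτ, AlgEquiv.symm_apply_apply]
  simp only [logDerivation_apply, AlgEquiv.trans_apply, AlgEquiv.symm_trans_apply, AlgEquiv.symm_symm, map_sub, h1, h2]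

/-- The same conjugation written as `τΦτ⁻¹` (derived here): `X_{τΦτ⁻¹} = τ ∘ X_Φ ∘ τ⁻¹`.
[cite: AbramovichTemkinWlodarczyk2024, §5.1 (p. 1575)] -/
theorem logDerivation_conj_symm (τ : B ≃ₐ[R] B) (hτ : ∀ b, τ (D b) = D (τ b)) (b : B) :
    logDerivation D ((τ.symm.trans Φ).trans τ) b = τ (logDerivation D Φ (τ.symm b)) := by
  have h := logDerivation_conj D Φ τ.symm (symm_map_eq_of_commute hτ) b
  rwa [AlgEquiv.symm_symm] at h

/-- **T22 (b): `(Rα) ⇒ (R∂)`** (derived here; THEOREM-FQ-eng1-g34 §16.5 (v.1)–(v.2)).  If `D R = 0` and `Φ R = R − P` then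
`X_Φ R = −Φ⁻¹ (D P)`. [cite: AbramovichTemkinWlodarczyk2024, §5.1 (p. 1575)] -/
theorem logDerivation_eq_neg_of_map_eq_sub {Rr P : B} (hR : D Rr = 0) (h : Φ Rr = Rr - P) :
    logDerivation D Φ Rr = -Φ.symm (D P) := by
  rw [logDerivation_apply, hR, sub_zero, h, map_sub, hR, zero_sub, map_neg]

/-- **T21 addendum (4₁)** (derived here; THEOREM-FQ-eng1-g34 §16): if `D G₀ = 0`, `D K = 0`, `D Bb = 0` and
`Φ G₀ = G₀ − Bb·Φ K` (a boundary relation whose cofactor `K` is NOT `Φ`-invariant), then `X_Φ G₀ = −Φ⁻¹(Bb)·X_Φ K`.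
[cite: AbramovichTemkinWlodarczyk2024, §5.1 (p. 1575)] -/
theorem logDerivation_eq_neg_mul_of_map_eq_sub_mul {G₀ K Bb : B} (hG : D G₀ = 0) (hK : D K = 0) (hB : D Bb = 0)
    (h : Φ G₀ = G₀ - Bb * Φ K) : logDerivation D Φ G₀ = -(Φ.symm Bb * logDerivation D Φ K) := by
  rw [logDerivation_apply_of_apply_eq_zero D Φ hG, logDerivation_apply_of_apply_eq_zero D Φ hK, h, map_sub, hG, zero_sub,
    Derivation.leibniz, hB, smul_zero, add_zero, smul_eq_mul, map_neg, map_mul]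

/-- A boundary relation with several bands (derived here; THEOREM-FQ-eng1-g34 §16 (4♭′) has two): `D G₀ = 0`, `D (K j) = 0`, `D (Bb j) = 0`,
`Φ G₀ = G₀ − Σ_j Bb_j·Φ (K j)` ⇒ `X_Φ G₀ = −Σ_j Φ⁻¹(Bb_j)·X_Φ (K j)`. [cite: AbramovichTemkinWlodarczyk2024, §5.1 (p. 1575)] -/
theorem logDerivation_eq_neg_sum_of_map_eq_sub_sum {ι : Type*} (s : Finset ι) {G₀ : B} {K Bb : ι → B} (hG : D G₀ = 0)
    (hK : ∀ j ∈ s, D (K j) = 0) (hB : ∀ j ∈ s, D (Bb j) = 0) (h : Φ G₀ = G₀ - ∑ j ∈ s, Bb j * Φ (K j)) :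
    logDerivation D Φ G₀ = -∑ j ∈ s, Φ.symm (Bb j) * logDerivation D Φ (K j) := by
  rw [logDerivation_apply_of_apply_eq_zero D Φ hG, h, map_sub, hG, zero_sub, map_sum, map_neg, map_sum, Finset.sum_congr rfl]
  intro j hj
  rw [logDerivation_apply_of_apply_eq_zero D Φ (hK j hj), Derivation.leibniz, hB j hj, smul_zero, add_zero, smul_eq_mul, map_mul]

/-- TWO BANDS (derived here; THEOREM-FQ-eng1-g34 §16 (4♭′) has bands at `σ^p` and `σ^{3p}`): `D G₀ = D K₁ = D K₂ = D B₁ = D B₂ = 0` and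
`Φ G₀ = G₀ − B₁·Φ K₁ − B₂·Φ K₂ ⇒ X_Φ G₀ = −Φ⁻¹(B₁)·X_Φ K₁ − Φ⁻¹(B₂)·X_Φ K₂`. [cite: AbramovichTemkinWlodarczyk2024, §5.1 (p. 1575)] -/
theorem logDerivation_eq_of_map_eq_sub_sub {G₀ K₁ K₂ B₁ B₂ : B} (hG : D G₀ = 0) (hK₁ : D K₁ = 0) (hK₂ : D K₂ = 0)
    (hB₁ : D B₁ = 0) (hB₂ : D B₂ = 0) (h : Φ G₀ = G₀ - B₁ * Φ K₁ - B₂ * Φ K₂) :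
    logDerivation D Φ G₀ = -(Φ.symm B₁ * logDerivation D Φ K₁) - Φ.symm B₂ * logDerivation D Φ K₂ := by
  rw [logDerivation_apply_of_apply_eq_zero D Φ hG, logDerivation_apply_of_apply_eq_zero D Φ hK₁,
    logDerivation_apply_of_apply_eq_zero D Φ hK₂, h, map_sub D, map_sub D, hG, zero_sub, Derivation.leibniz, hB₁, smul_zero, add_zero,
    smul_eq_mul, Derivation.leibniz, hB₂, smul_zero, add_zero, smul_eq_mul, map_sub, map_neg, map_mul, map_mul]

/-- `X_Φ` vanishes on the constants fixed by `Φ` together with their derivative (derived here; e.g. `s = σ`: `Φ σ = σ`, `D σ = 1`).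
[cite: AbramovichTemkinWlodarczyk2024, §5.1 (p. 1575)] -/
theorem logDerivation_eq_zero_of_fixed {s : B} (hs : Φ s = s) (hDs : Φ (D s) = D s) : logDerivation D Φ s = 0 := by
  rw [logDerivation_apply, hs, sub_eq_zero]
  calc Φ.symm (D s) = Φ.symm (Φ (D s)) := by rw [hDs]
    _ = D s := Φ.symm_apply_apply _

/-- … hence is linear over them: `X_Φ (s·b) = s·X_Φ b` (derived here). [cite: AbramovichTemkinWlodarczyk2024, §5.1 (p. 1575)] -/
theorem logDerivation_mul_of_fixed {s : B} (hs : Φ s = s) (hDs : Φ (D s) = D s) (b : B) :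
    logDerivation D Φ (s * b) = s * logDerivation D Φ b := by
  rw [Derivation.leibniz, logDerivation_eq_zero_of_fixed D Φ hs hDs, smul_zero, add_zero, smul_eq_mul]

end Abstract

section Model

open Polynomial

variable (R : Type*) {A : Type*} [CommRing R] [CommRing A] [Algebra R A]

/-- `∂_σ` on `A[σ] = A[X]` as an `R`-derivation (`Polynomial.derivative`, scalars restricted from `A` to `R`; in the cell `A = k[ε_ι]`,
`R = k`) (model). [cite: Matsumura1987, §25 (derivations)] -/
noncomputable def sigmaDeriv (A : Type*) [CommRing A] [Algebra R A] : Derivation R A[X] A[X] :=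
  (derivative' : Derivation A A[X] A[X]).restrictScalars R

/-- Unfolding (derived here). [cite: Matsumura1987, §25 (derivations)] -/
@[simp] theorem sigmaDeriv_apply (f : A[X]) : sigmaDeriv R A f = derivative f := rfl

variable {R}

/-- The `σ^k`-LAYER `X_k` of an `R`-derivation `X` of `A[σ]`: `a ↦ [σ^k] X(C a)`; it is an `R`-derivation of `A` because
`X(C(ab)) = C a·X(C b) + C b·X(C a)` and `[σ^k]` is `A`-linear (model; engine 1's `X̄ = Σ_k σ^k X̄_k`).
[cite: Matsumura1987, §25 (derivations)] -/
noncomputable def coeffLayer (Xd : Derivation R A[X] A[X]) (k : ℕ) : Derivation R A A where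
  toFun a := (Xd (C a)).coeff k
  map_add' a b := by simp only [map_add, coeff_add]
  map_smul' r a := by
    simp only [RingHom.id_apply]
    rw [← smul_C, Derivation.map_smul, coeff_smul]
  map_one_eq_zero' := by
    simp only [LinearMap.coe_mk, AddHom.coe_mk, map_one, Derivation.map_one_eq_zero, coeff_zero]
  leibniz' a b := by
    simp only [LinearMap.coe_mk, AddHom.coe_mk, C_mul, Derivation.leibniz, smul_eq_mul, coeff_add, coeff_C_mul]

/-- Unfolding (derived here). [cite: Matsumura1987, §25 (derivations)] -/
@[simp] theorem coeffLayer_apply (Xd : Derivation R A[X] A[X]) (k : ℕ) (a : A) : coeffLayer Xd k a = (Xd (C a)).coeff k := rfl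

/-- Two `R`-derivations of `A[σ]` agreeing on `σ` and on `A` are equal (derived here). [cite: Matsumura1987, §25 (derivations)] -/
theorem derivation_polynomial_ext {M : Type*} [AddCommGroup M] [Module A[X] M] [Module R M] {D₁ D₂ : Derivation R A[X] M}
    (hX : D₁ X = D₂ X) (hC : ∀ a, D₁ (C a) = D₂ (C a)) : D₁ = D₂ := by
  ext p
  refine Polynomial.induction_on p hC (fun p q hp hq => by rw [map_add, map_add, hp, hq]) fun n a ih => ?_
  rw [pow_succ, ← mul_assoc, Derivation.leibniz, Derivation.leibniz D₂, ih, hX]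

/-- Two `k`-derivations of `k[ε_ι][σ]` agreeing on `σ` and on the `ε_i` are equal (derived here) — so a derivation `X` of `k[ε][σ]` with
`X σ = 0` IS `Σ_i X(ε_i)·∂_i` extended `σ`-linearly (engine 1's `X̄ = Σ_i h̄_i ∂_i`). [cite: Matsumura1987, §25 (derivations)] -/
theorem derivation_mvPolynomialX_ext {k ι : Type*} [CommRing k]
    {D₁ D₂ : Derivation k (MvPolynomial ι k)[X] (MvPolynomial ι k)[X]} (hX : D₁ X = D₂ X)
    (hε : ∀ i, D₁ (C (MvPolynomial.X i)) = D₂ (C (MvPolynomial.X i))) : D₁ = D₂ := by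
  refine derivation_polynomial_ext hX fun a => ?_
  have h : D₁.compAlgebraMap (MvPolynomial ι k) = D₂.compAlgebraMap (MvPolynomial ι k) :=
    MvPolynomial.derivation_ext fun i => by
      change D₁ (algebraMap (MvPolynomial ι k) (MvPolynomial ι k)[X] (MvPolynomial.X i))
        = D₂ (algebraMap (MvPolynomial ι k) (MvPolynomial ι k)[X] (MvPolynomial.X i))
      rw [Polynomial.algebraMap_eq]
      exact hε i
  have ha := Derivation.congr_fun h a
  change D₁ (algebraMap (MvPolynomial ι k) (MvPolynomial ι k)[X] a) = D₂ (algebraMap (MvPolynomial ι k) (MvPolynomial ι k)[X] a) at ha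
  rwa [Polynomial.algebraMap_eq] at ha

variable (Φ : A[X] ≃ₐ[R] A[X])

/-- **The `hder` of `WeightedCentreNoBands`, verbatim** (derived here): with `X̄ a := X_Φ (C a)`, `Φ (X̄ a) = ∂_σ (Φ (C a))` for every
`σ`-free `a`. [cite: AbramovichTemkinWlodarczyk2024, §5.1 (p. 1575)] -/
theorem map_logDerivation_C (a : A) : Φ (logDerivation (sigmaDeriv R A) Φ (C a)) = derivative (Φ (C a)) :=
  map_logDerivation_of_apply_eq_zero (sigmaDeriv R A) Φ (by rw [sigmaDeriv_apply, derivative_C])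

/-- `X_Φ (C a) = Φ⁻¹ (∂_σ (Φ (C a)))` (derived here; for `a = ε_i` and `Φ = Ψ̄: ε ↦ ε + Ā` this is engine 1's
`h̄_i = (∂_σ Ā_i)(σ, ε' + B̄(σ, ε'))`, THEOREM-LC STEP 4). [cite: AbramovichTemkinWlodarczyk2024, §5.1 (p. 1575)] -/
theorem logDerivation_C (a : A) : logDerivation (sigmaDeriv R A) Φ (C a) = Φ.symm (derivative (Φ (C a))) :=
  logDerivation_apply_of_apply_eq_zero (sigmaDeriv R A) Φ (by rw [sigmaDeriv_apply, derivative_C])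

/-- If `Φ σ = σ` then `X_Φ σ = 0` (derived here). [cite: AbramovichTemkinWlodarczyk2024, §5.1 (p. 1575)] -/
theorem logDerivation_X_eq_zero (hX : Φ X = X) : logDerivation (sigmaDeriv R A) Φ X = 0 :=
  logDerivation_eq_zero_of_fixed (sigmaDeriv R A) Φ hX (by rw [sigmaDeriv_apply, derivative_X, map_one])

/-- … and `X_Φ` is `σ`-linear: `X_Φ (σ^n f) = σ^n X_Φ f` (derived here). [cite: AbramovichTemkinWlodarczyk2024, §5.1 (p. 1575)] -/
theorem logDerivation_X_pow_mul (hX : Φ X = X) (n : ℕ) (f : A[X]) :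
    logDerivation (sigmaDeriv R A) Φ (X ^ n * f) = X ^ n * logDerivation (sigmaDeriv R A) Φ f := by
  rw [Derivation.leibniz, Derivation.leibniz_pow, logDerivation_X_eq_zero Φ hX, smul_zero, smul_zero, smul_zero, add_zero, smul_eq_mul]

/-- **`(Rα) ⇒ (R∂)` in the model** (derived here; THEOREM-FQ-eng1-g34 §16.5): `Φ (C R) = C R − P ⇒ X_Φ (C R) = −Φ⁻¹ (∂_σ P)`.
[cite: AbramovichTemkinWlodarczyk2024, §5.1 (p. 1575)] -/
theorem logDerivation_C_eq_neg_of_map_C_eq_sub {r : A} {P : A[X]} (h : Φ (C r) = C r - P) :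
    logDerivation (sigmaDeriv R A) Φ (C r) = -Φ.symm (derivative P) :=
  logDerivation_eq_neg_of_map_eq_sub (sigmaDeriv R A) Φ (by rw [sigmaDeriv_apply, derivative_C]) h

/-- **(4₁) in the model** (derived here; THEOREM-FQ-eng1-g34 §16): `Φ (C G₀) = C G₀ − Bb·Φ (C K)` with `∂_σ Bb = 0` (in characteristic `p`:
`Bb = C(c^p)·σ^{e}`, `p ∣ e`) ⇒ `X_Φ (C G₀) = −Φ⁻¹(Bb)·X_Φ (C K)`. [cite: AbramovichTemkinWlodarczyk2024, §5.1 (p. 1575)] -/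
theorem logDerivation_C_eq_neg_mul_of_boundary_relation {G₀ K : A} {Bb : A[X]} (hB : derivative Bb = 0)
    (h : Φ (C G₀) = C G₀ - Bb * Φ (C K)) :
    logDerivation (sigmaDeriv R A) Φ (C G₀) = -(Φ.symm Bb * logDerivation (sigmaDeriv R A) Φ (C K)) :=
  logDerivation_eq_neg_mul_of_map_eq_sub_mul (sigmaDeriv R A) Φ (by rw [sigmaDeriv_apply, derivative_C])
    (by rw [sigmaDeriv_apply, derivative_C]) (by rw [sigmaDeriv_apply, hB]) h

/-- **(4₁) layer by layer, below the band** (derived here): if moreover `Φ⁻¹ Bb = C b·σ^e` then `X_k G₀ = 0` for `k < e`.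
[cite: AbramovichTemkinWlodarczyk2024, §5.1 (p. 1575)] -/
theorem coeffLayer_eq_zero_of_boundary_relation {G₀ K b : A} {Bb : A[X]} {e : ℕ} (hB : derivative Bb = 0)
    (h : Φ (C G₀) = C G₀ - Bb * Φ (C K)) (hBb : Φ.symm Bb = C b * X ^ e) {k : ℕ} (hk : k < e) :
    coeffLayer (logDerivation (sigmaDeriv R A) Φ) k G₀ = 0 := by
  rw [coeffLayer_apply, logDerivation_C_eq_neg_mul_of_boundary_relation Φ hB h, hBb, coeff_neg, mul_assoc, coeff_C_mul,
    coeff_X_pow_mul', if_neg (not_le.mpr hk), mul_zero, neg_zero]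

/-- **(4₁) layer by layer, on and above the band** (derived here): if `Φ⁻¹ Bb = C b·σ^e` then `X_{j+e} G₀ = −b·X_j K`.
[cite: AbramovichTemkinWlodarczyk2024, §5.1 (p. 1575)] -/
theorem coeffLayer_add_eq_of_boundary_relation {G₀ K b : A} {Bb : A[X]} {e : ℕ} (hB : derivative Bb = 0)
    (h : Φ (C G₀) = C G₀ - Bb * Φ (C K)) (hBb : Φ.symm Bb = C b * X ^ e) (j : ℕ) :
    coeffLayer (logDerivation (sigmaDeriv R A) Φ) (j + e) G₀ = -(b * coeffLayer (logDerivation (sigmaDeriv R A) Φ) j K) := by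
  rw [coeffLayer_apply, coeffLayer_apply, logDerivation_C_eq_neg_mul_of_boundary_relation Φ hB h, hBb, coeff_neg, mul_assoc,
    coeff_C_mul, coeff_X_pow_mul]

/-- **(4♭′) in the model, two bands** (derived here; THEOREM-FQ-eng1-g34 §16, LEMMA 4♭′): `Φ (C G₀) = C G₀ − B₁·Φ (C K₁) − B₂·Φ (C K₂)` with
`∂_σ B₁ = ∂_σ B₂ = 0` ⇒ `X_Φ (C G₀) = −Φ⁻¹(B₁)·X_Φ (C K₁) − Φ⁻¹(B₂)·X_Φ (C K₂)`. [cite: AbramovichTemkinWlodarczyk2024, §5.1 (p. 1575)] -/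
theorem logDerivation_C_eq_of_two_bands {G₀ K₁ K₂ : A} {B₁ B₂ : A[X]} (hB₁ : derivative B₁ = 0) (hB₂ : derivative B₂ = 0)
    (h : Φ (C G₀) = C G₀ - B₁ * Φ (C K₁) - B₂ * Φ (C K₂)) :
    logDerivation (sigmaDeriv R A) Φ (C G₀)
      = -(Φ.symm B₁ * logDerivation (sigmaDeriv R A) Φ (C K₁)) - Φ.symm B₂ * logDerivation (sigmaDeriv R A) Φ (C K₂) :=
  logDerivation_eq_of_map_eq_sub_sub (sigmaDeriv R A) Φ (by rw [sigmaDeriv_apply, derivative_C]) (by rw [sigmaDeriv_apply, derivative_C])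
    (by rw [sigmaDeriv_apply, derivative_C]) (by rw [sigmaDeriv_apply, hB₁]) (by rw [sigmaDeriv_apply, hB₂]) h

/-- **(4♭′) layer by layer, below both bands** (derived here): with `Φ⁻¹ B₁ = C b₁·σ^{e₁}`, `Φ⁻¹ B₂ = C b₂·σ^{e₂}`: `X_k G₀ = 0` for
`k < e₁`, `k < e₂`. [cite: AbramovichTemkinWlodarczyk2024, §5.1 (p. 1575)] -/
theorem coeffLayer_eq_zero_of_two_bands {G₀ K₁ K₂ b₁ b₂ : A} {B₁ B₂ : A[X]} {e₁ e₂ : ℕ} (hB₁ : derivative B₁ = 0)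
    (hB₂ : derivative B₂ = 0) (h : Φ (C G₀) = C G₀ - B₁ * Φ (C K₁) - B₂ * Φ (C K₂)) (hb₁ : Φ.symm B₁ = C b₁ * X ^ e₁)
    (hb₂ : Φ.symm B₂ = C b₂ * X ^ e₂) {k : ℕ} (hk₁ : k < e₁) (hk₂ : k < e₂) :
    coeffLayer (logDerivation (sigmaDeriv R A) Φ) k G₀ = 0 := by
  rw [coeffLayer_apply, logDerivation_C_eq_of_two_bands Φ hB₁ hB₂ h, hb₁, hb₂, coeff_sub, coeff_neg, mul_assoc, coeff_C_mul,
    coeff_X_pow_mul', if_neg (not_le.mpr hk₁), mul_zero, neg_zero, mul_assoc, coeff_C_mul, coeff_X_pow_mul',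
    if_neg (not_le.mpr hk₂), mul_zero, sub_zero]

/-- **(4♭′) layer by layer, between the bands** (derived here; engine 1: `X̿_k G₀₀ = −ℓ̄₁^p·X̿_{k−p} K₁` for `p ≤ k < 3p`, i.e. `e₁ = p`,
`e₂ = 3p`, `b₁ = ℓ̄₁^p`): `X_{j+e₁} G₀ = −b₁·X_j K₁` for `j + e₁ < e₂`. [cite: AbramovichTemkinWlodarczyk2024, §5.1 (p. 1575)] -/
theorem coeffLayer_add_eq_of_two_bands {G₀ K₁ K₂ b₁ b₂ : A} {B₁ B₂ : A[X]} {e₁ e₂ : ℕ} (hB₁ : derivative B₁ = 0)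
    (hB₂ : derivative B₂ = 0) (h : Φ (C G₀) = C G₀ - B₁ * Φ (C K₁) - B₂ * Φ (C K₂)) (hb₁ : Φ.symm B₁ = C b₁ * X ^ e₁)
    (hb₂ : Φ.symm B₂ = C b₂ * X ^ e₂) {j : ℕ} (hj : j + e₁ < e₂) :
    coeffLayer (logDerivation (sigmaDeriv R A) Φ) (j + e₁) G₀ = -(b₁ * coeffLayer (logDerivation (sigmaDeriv R A) Φ) j K₁) := by
  rw [coeffLayer_apply, coeffLayer_apply, logDerivation_C_eq_of_two_bands Φ hB₁ hB₂ h, hb₁, hb₂, coeff_sub, coeff_neg, mul_assoc,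
    coeff_C_mul, coeff_X_pow_mul, mul_assoc, coeff_C_mul, coeff_X_pow_mul', if_neg (not_le.mpr hj), mul_zero, sub_zero]

/-- `σ`-free automorphisms commute with `∂_σ` (derived here): for `τ₀ : A ≃ₐ[R] A` acting on coefficients (`τ = mapAlgEquiv τ₀`),
`τ (∂_σ f) = ∂_σ (τ f)`. [cite: Matsumura1987, §25 (derivations)] -/
theorem mapAlgEquiv_derivative (τ₀ : A ≃ₐ[R] A) (f : A[X]) : mapAlgEquiv τ₀ (derivative f) = derivative (mapAlgEquiv τ₀ f) := by
  rw [coe_mapAlgEquiv, derivative_map]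

/-- … in `Derivation` form (derived here). [cite: Matsumura1987, §25 (derivations)] -/
theorem mapAlgEquiv_sigmaDeriv (τ₀ : A ≃ₐ[R] A) (f : A[X]) : mapAlgEquiv τ₀ (sigmaDeriv R A f) = sigmaDeriv R A (mapAlgEquiv τ₀ f) :=
  mapAlgEquiv_derivative τ₀ f

/-- Unfolding the inverse of a `σ`-free automorphism (plumbing, derived here). [cite: Matsumura1987, §25 (derivations)] -/
theorem mapAlgEquiv_symm_apply (τ₀ : A ≃ₐ[R] A) (f : A[X]) : (mapAlgEquiv τ₀).symm f = mapAlgEquiv τ₀.symm f := rfl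

/-- A `σ`-free automorphism has zero log-derivative (derived here; "the log-derivative method is blind to `σ`-free substitutions").
[cite: AbramovichTemkinWlodarczyk2024, §5.1 (p. 1575)] -/
theorem logDerivation_mapAlgEquiv (τ₀ : A ≃ₐ[R] A) : logDerivation (sigmaDeriv R A) (mapAlgEquiv τ₀) = 0 :=
  logDerivation_eq_zero_of_commute (sigmaDeriv R A) _ (mapAlgEquiv_derivative τ₀)

/-- **T22 (a) in the model** (derived here; THEOREM-FQ-eng1-g34 §16.5 (v.0)): for a `σ`-free `τ = mapAlgEquiv τ₀`,
`X_{τ⁻¹Φτ} = τ⁻¹ ∘ X_Φ ∘ τ`. [cite: AbramovichTemkinWlodarczyk2024, §5.1 (p. 1575)] -/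
theorem logDerivation_mapAlgEquiv_conj (τ₀ : A ≃ₐ[R] A) (f : A[X]) :
    logDerivation (sigmaDeriv R A) (((mapAlgEquiv τ₀).trans Φ).trans (mapAlgEquiv τ₀).symm) f
      = (mapAlgEquiv τ₀).symm (logDerivation (sigmaDeriv R A) Φ (mapAlgEquiv τ₀ f)) :=
  logDerivation_conj (sigmaDeriv R A) Φ _ (mapAlgEquiv_derivative τ₀) f

/-- **T22 (a), `σ`-degree by `σ`-degree** (derived here): `(X_{τ⁻¹Φτ})_k = τ₀⁻¹ ∘ (X_Φ)_k ∘ τ₀` for a `σ`-free `τ = mapAlgEquiv τ₀`.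
[cite: AbramovichTemkinWlodarczyk2024, §5.1 (p. 1575)] -/
theorem coeffLayer_logDerivation_conj (τ₀ : A ≃ₐ[R] A) (k : ℕ) (a : A) :
    coeffLayer (logDerivation (sigmaDeriv R A) (((mapAlgEquiv τ₀).trans Φ).trans (mapAlgEquiv τ₀).symm)) k a
      = τ₀.symm (coeffLayer (logDerivation (sigmaDeriv R A) Φ) k (τ₀ a)) := by
  rw [coeffLayer_apply, coeffLayer_apply, logDerivation_mapAlgEquiv_conj, mapAlgEquiv_symm_apply, coe_mapAlgEquiv, coe_mapAlgEquiv,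
    map_C, coeff_map]
  rfl

end Model

end Literature.AlgebraicGeometry.Resolution.WeightedBlowup
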